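import Summits.QuantumFields.YangMills.Theses.ParabolicTrajectory
import Summits.QuantumFields.YangMills.Theorems.ParabolicTrajectoryTunedSequenceExistsSlackDefs
import Summits.QuantumFields.YangMills.Theorems.ParabolicTrajectoryTunedSequenceExistsQFemtoCorollaries
import Summits.QuantumFields.YangMills.Theorems.ParabolicTrajectoryTunedSequenceExistsQFemtoAspectwise
import Summits.QuantumFields.YangMills.Theorems.ParabolicTrajectoryTunedSequenceExistsPVGGlue

/-!
# Line `fixed-aspect-window` for the crux `ParabolicTrajectory.TunedSequenceExists`
# (stmt-QuantumFields-10524) — checked skeleton, RESHAPED by lead c6 (2026-08-17): 4 stubs, the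
# (U),(V) pair in its WEAKEST COMPOSING FORM; lead c12 (2026-08-17): SECOND composition
# `TunedSequenceExistsPVG_of` — the same 4 stubs close the REPAIRED conjunct of the rev-8 banner

## Lead c12 addendum — the repaired conjunct (S_PVG)

The (A) chain (stmt-QuantumFields-10522) certified (A) misstated as typed (torus seam along slow-volume
schemes) and the (A)/(B) chains' unified rev-8 banner restates OUR crux as
`TwoOrbitSynchronisation.TunedSequenceExistsPVG` ((S) verbatim + polynomial volume growth
`∃ N ≥ 1, ∀ᶠ k, a_k⁻¹ ≤ (a_k L_k)^N` in the CONCLUSION; `…ContinuumLimitOnTrajectoryDefsG`, deciding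
theorems `closesPVG` / `RegimeTrisection.yangMills_of_subs` / `TrisectionGap.yangMills_of_trisectionGap`).
The growth clause is NOT free from the window-form core (`Negative.Glue.weak_of_lowerBound` chooses the
volume after the depth: `a_k L_k ≥ k` only) but IS free from the registered stubs: (U_∃h)+(V_slack) give
the ALL-VOLUME lower bound, the IVT glue then PRESCRIBES `M^(2 m_k) ≤ L_k`, and the diagonal extraction
carries the clause (`Theorems/ParabolicTrajectoryTunedSequenceExistsPVGGlue.lean`, p167112, LANDED).
Hence the second composition below: the stubs are unchanged, the line survives the restatement intact,
and `PVGGlue.tunedSequenceExistsPVG_of_slack_mirror_subs` is the `--glue-by` declaration of a four-child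
route-level split of (S_PVG) (three children with `PVGGlue.tunedSequenceExistsPVG_of_sharp_mirror_subs`).

Crux (route `ParabolicTrajectory`, item stmt-QuantumFields-10524, (S) of the thesis): for every
compact simple Lie `G`, faithful unitary `r`, `M ≥ 2` there is a window `(0, θ₀)` of tuned limits
`θ` of `N_1(k) = (M^{n_k})^8 ⟨P ; τ_{M^{n_k}} P⟩_{β_k, 2L_k+1}` along SOME `M`-adic Wilson scheme with
`β_k → ∞`, all `N_t(k)`, `t ≥ 1`, convergent.  `u(β, m, L) := (M^m)^8 ⟨P ; τ_{M^m} P⟩_{β, 2L+1}`,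
`P = r.curvature.F` (Wilson's CORNER action density), `Pᴿ := P ∘ cfgReflect` its time mirror.

## What changed in this reshape (previous skeleton sha 5c201e77, stubs U / V / A_in / A_out of leads c4–c5)

The composition of the previous skeleton (`FixedAspectSplit.lowerBound_of_femto_of_volume`) used (U)
`FemtoWindow` with the explicit height `c / log² L₁` and (V) `VolumeMonotone` with the additive
tolerance `c / log² L₁` for EVERY `c > 0`.  Two facts (file
`Theorems/ParabolicTrajectoryTunedSequenceExistsSlackDefs.lean`, p153967, LANDED):

* the composition never uses the RATE: at ONE aspect beyond both floors it needs SOME positive height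
  from (U) and a volume comparison losing less than that height.  So (U) weakens to **(U_∃h)
  `FixedAspectSplit.FemtoLowerBound`** — `∃ LU, ∀ L₁ ≥ LU, ∃ h > 0, ∀ B m₀, ∃ m ≥ m₀, ∃ β ≥ B,
  h ≤ u(β, m, L₁M^m)` — STRICTLY weaker (`femtoLowerBound_of_femtoWindow`, kernel-checked);
* the additive `∀ c` tolerance of the old (V) silently demands RELATIVE PRECISION → 0 between two femto
  tori (both sides are `≍ 1/log² L₁` there): two-sided UV asymptotics, not thermodynamic-limit content —
  the sibling bracket `cΓ ≤ u ≤ CΓ` (stmt-QuantumFields-16204) compares femto tori up to the factor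
  `C/c`, never to precision `o(Γ)`.  So (V) becomes the constant-factor-plus-slack **(V_slack)
  `FixedAspectSplit.VolumeMonotoneSlack`** — `∃ K > 0, ∃ LV, ∀ L₁ ≥ LV, ∀ ε > 0, ∃ β₁ m₁, ∀ β ≥ β₁,
  m ≥ m₁, L ≥ L₁M^m: u(β, m, L₁M^m) ≤ K · u(β, m, L) + ε` — implied by the purely relative form
  (`volumeMonotoneSlack_of_rel`), bounded depth free (`volumeSlack_of_depth_le`, uniform freezing),
  depth floor idle (`volumeMonotoneSlack_iff_allDepths`); for the time-zero plaquette `Q` its femto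
  corners are free modulo stmt-16204 (`QFemto.volumeSlackQ_femto_pair` with `K = C/c`,
  `QFemto.volumeSlackQ_femto_small`; file `…QSlack.lean`).
  Composition: `lowerBound_of_femtoLower_of_volumeSlack` (`ε := h/2`, `θ₀ := h/(2K)`).

(A_in) `stub_mirrorBoundIn`, (A_out) `stub_mirrorBoundOut` are unchanged (lead c4: canonical ceilings
for the two RP-diagonal mirror correlators; femto part ⟸ stmt-16204, `PairCeiling`, p144414).

## The stubs and why none is the crux core

* `stub_femtoLowerBound` (U_∃h; UV; for `Q` it IS the sibling crux stmt-16204 —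
  `QFemto.femtoLowerBoundQ_of_femtoCurvatureTwoPointC` — for the corner density `P` it is one channel
  of 36 and does not transfer): pins the aspect; its height may decay with the aspect, so no `θ₀`
  uniform in `L₀` — not ≥ CORE (`femtoLowerBoundShape_aspectDecay` + `not_lowerBoundShape_aspectDecay`).
* `stub_volumeSlack` (V_slack; IR; open — the weak-coupling thermodynamic limit of one rescaled
  covariance at physical separations bounded away from `0`, necessary by
  `QFemto.tunedSequenceExists_witnesses_not_femto`): zero table inhabits it
  (`volumeMonotoneSlackShape_zero`) — not ≥ CORE.
* `stub_mirrorBoundIn`, `stub_mirrorBoundOut` (A_in / A_out; UV + crossover, ≥ U): UPPER bounds only,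
  zero table inhabits them (`canonicalUpperBoundShape_zero`) — not ≥ CORE.

Composition (`TunedSequenceExists_of`, sorry-free): the landed four-child glue
`FixedAspectSplit.tunedSequenceExists_of_slack_mirror_subs` ((A_in)+(A_out) ⇒ (A) by odd-torus RP +
Cauchy–Schwarz, `MirrorBound.canonicalUpperBoundAll_of_mirror`; (U_∃h)+(V_slack) ⇒ the core; exact
tuning by IVT (`Negative.Glue.weak_of_lowerBound`); (A) ⇒ a-priori bound ⇒ diagonal extraction).

Disproof used (unchanged since gen 3): honours `not_windowAtZero` / `FixedCouplingUltralocality`,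
`not_windowDominating`, `not_window_uniform`, `window_iff_windowBdd`, `weak_iff_lowerBound`,
`not_uniformClustering_of_window`; `RPStraddleCounterexample` respected — RP enters ONLY through the
mirror Cauchy–Schwarz bound for the cross structure of `P`, never as monotonicity of `⟨P ; τ P⟩` itself.
-/

noncomputable section

open Filter Topology MeasureTheory
open Literature.MathematicalPhysics.QuantumFieldTheory Literature.MathematicalPhysics.QuantumLattice
open Summit.QuantumFields.YangMills.Theorems.TunedSequenceExists

namespace Summit.QuantumFields.YangMills.Cruxes.TunedSequenceExists.FixedAspectWindow

/-! ## The sub-statements are LANDED names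

(U_∃h) `FixedAspectSplit.FemtoLowerBound[All]`, (V_slack) `FixedAspectSplit.VolumeMonotoneSlack[All]`
(`…SlackDefs`, p153967); (A_in) `FixedAspectSplit.MirrorBoundIn[All]`, (A_out)
`FixedAspectSplit.MirrorBoundOut[All]` (`…MirrorDefs`, p141070).  Nothing is restated here. -/

/-! ## The registered stubs (`sorry` lives ONLY here) -/

/-- **STUB 1 · `stub_femtoLowerBound`** (U_∃h; UV: a positive lower bound on the rescaled corner-density
correlator at ONE pinned aspect beyond every coupling/depth floor — Bałaban CMP 109/116/119/122 in
finite physical volume + two `tr F²` insertions with tree-level dominance of the 36-channel sum; any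
positive height will do).  `= FixedAspectSplit.FemtoLowerBoundAll` verbatim. -/
theorem stub_femtoLowerBound :
    ∀ (G : Type) [Group G] [TopologicalSpace G] [IsTopologicalGroup G] [CompactSpace G],
      IsCompactSimpleLieGroup G → letI : MeasurableSpace G := borel G
      haveI : BorelSpace G := ⟨rfl⟩
      ∀ (r : LatticeRep G) (M : ℕ), 2 ≤ M →
    ∃ LU : ℕ, ∀ L₁ : ℕ, LU ≤ L₁ → ∃ h : ℝ, 0 < h ∧ ∀ (B : ℝ) (m₀ : ℕ),
      ∃ m : ℕ, m₀ ≤ m ∧ ∃ β : ℝ, B ≤ β ∧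
        h ≤ ((M : ℝ) ^ m) ^ 8 *
          latticeConnectedCorr r.ρ β (2 * (L₁ * M ^ m) + 1) r.curvature.F r.curvature.F (M ^ m) := by
  sorry

/-- **STUB 2 · `stub_volumeSlack`** (V_slack; IR, open: constant-factor-plus-slack comparison of the
rescaled corner-density correlator between the aspect-`L₁` torus and every larger one at weak coupling;
bounded depth is free by `FixedAspectSplit.volumeSlack_of_depth_le`, the content is the joint tail
`m → ∞` at physical separations bounded away from `0`).  `= FixedAspectSplit.VolumeMonotoneSlackAll`
verbatim. -/
theorem stub_volumeSlack :
    ∀ (G : Type) [Group G] [TopologicalSpace G] [IsTopologicalGroup G] [CompactSpace G],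
      IsCompactSimpleLieGroup G → letI : MeasurableSpace G := borel G
      haveI : BorelSpace G := ⟨rfl⟩
      ∀ (r : LatticeRep G) (M : ℕ), 2 ≤ M →
    ∃ K : ℝ, 0 < K ∧ ∃ LV : ℕ, ∀ L₁ : ℕ, LV ≤ L₁ → ∀ ε : ℝ, 0 < ε → ∃ (β₁ : ℝ) (m₁ : ℕ),
      ∀ (β : ℝ) (m L : ℕ), β₁ ≤ β → m₁ ≤ m → L₁ * M ^ m ≤ L →
        ((M : ℝ) ^ m) ^ 8 *
            latticeConnectedCorr r.ρ β (2 * (L₁ * M ^ m) + 1) r.curvature.F r.curvature.F (M ^ m) ≤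
          K * (((M : ℝ) ^ m) ^ 8 *
            latticeConnectedCorr r.ρ β (2 * L + 1) r.curvature.F r.curvature.F (M ^ m)) + ε := by
  sorry

/-- **STUB 3 · `stub_mirrorBoundIn`** (A_in; size L, ≥ U: UV stability with ONE curvature insertion
carried through the crossover, for the RP-diagonal inward mirror correlator).
`= FixedAspectSplit.MirrorBoundInAll` verbatim. -/
theorem stub_mirrorBoundIn :
    ∀ (G : Type) [Group G] [TopologicalSpace G] [IsTopologicalGroup G] [CompactSpace G],
      IsCompactSimpleLieGroup G → letI : MeasurableSpace G := borel G
      haveI : BorelSpace G := ⟨rfl⟩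
      ∀ (r : LatticeRep G),
    ∃ (β₁ K : ℝ), ∀ β : ℝ, β₁ ≤ β → ∀ (L D : ℕ), D ≤ L →
      (D : ℝ) ^ 8 * |latticeConnectedCorr r.ρ β (2 * L + 1) r.curvature.F
        (fun V => r.curvature.F (cfgReflect V)) D| ≤ K := by
  sorry

/-- **STUB 4 · `stub_mirrorBoundOut`** (A_out; size L, ≥ U: the same for the outward mirror
correlator).  `= FixedAspectSplit.MirrorBoundOutAll` verbatim. -/
theorem stub_mirrorBoundOut :
    ∀ (G : Type) [Group G] [TopologicalSpace G] [IsTopologicalGroup G] [CompactSpace G],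
      IsCompactSimpleLieGroup G → letI : MeasurableSpace G := borel G
      haveI : BorelSpace G := ⟨rfl⟩
      ∀ (r : LatticeRep G),
    ∃ (β₁ K : ℝ), ∀ β : ℝ, β₁ ≤ β → ∀ (L D : ℕ), D ≤ L →
      (D : ℝ) ^ 8 * |latticeConnectedCorr r.ρ β (2 * L + 1)
        (fun V => r.curvature.F (cfgReflect V)) r.curvature.F D| ≤ K := by
  sorry

/-! ### Consistency: each named statement IS its registered stub (definitionally) -/

theorem femtoLowerBoundAll_holds : FixedAspectSplit.FemtoLowerBoundAll := stub_femtoLowerBound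
theorem volumeMonotoneSlackAll_holds : FixedAspectSplit.VolumeMonotoneSlackAll := stub_volumeSlack
theorem mirrorBoundInAll_holds : FixedAspectSplit.MirrorBoundInAll := stub_mirrorBoundIn
theorem mirrorBoundOutAll_holds : FixedAspectSplit.MirrorBoundOutAll := stub_mirrorBoundOut

/-- The old stub (A) is DERIVED: (A_in) + (A_out) ⇒ `CanonicalUpperBoundAll` (landed mirror glue). -/
theorem canonicalUpperBoundAll_holds : FixedAspectSplit.CanonicalUpperBoundAll :=
  MirrorBound.canonicalUpperBoundAll_of_mirror stub_mirrorBoundIn stub_mirrorBoundOut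

/-- The old stub (U) implies the new one (the reshape loses nothing on the (U) side). -/
example : FixedAspectSplit.FemtoWindowAll → FixedAspectSplit.FemtoLowerBoundAll :=
  FixedAspectSplit.femtoLowerBoundAll_of_femtoWindowAll

/-! ### Name-keyed aliases of the open statements (the hypotheses of the composition) -/
namespace Registered

/-- Alias of `FemtoLowerBoundAll` keyed by the registered stub name. -/
abbrev stub_femtoLowerBound : Prop := FixedAspectSplit.FemtoLowerBoundAll
/-- Alias of `VolumeMonotoneSlackAll` keyed by the registered stub name. -/
abbrev stub_volumeSlack : Prop := FixedAspectSplit.VolumeMonotoneSlackAll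
/-- Alias of `MirrorBoundInAll` keyed by the registered stub name. -/
abbrev stub_mirrorBoundIn : Prop := FixedAspectSplit.MirrorBoundInAll
/-- Alias of `MirrorBoundOutAll` keyed by the registered stub name. -/
abbrev stub_mirrorBoundOut : Prop := FixedAspectSplit.MirrorBoundOutAll

end Registered

/-! ## The composition: the four stubs imply the crux, BY NAME (kernel-checked; no `sorry` outside
the stubs) -/

/-- **`TunedSequenceExists_of`** — (U_∃h) `stub_femtoLowerBound`, (V_slack) `stub_volumeSlack`,
(A_in) `stub_mirrorBoundIn`, (A_out) `stub_mirrorBoundOut` imply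
`Summit.QuantumFields.YangMills.Theses.ParabolicTrajectory.TunedSequenceExists`:
the landed four-child glue `FixedAspectSplit.tunedSequenceExists_of_slack_mirror_subs`. -/
theorem TunedSequenceExists_of (hU : Registered.stub_femtoLowerBound)
    (hV : Registered.stub_volumeSlack) (hIn : Registered.stub_mirrorBoundIn)
    (hOut : Registered.stub_mirrorBoundOut) :
    Summit.QuantumFields.YangMills.Theses.ParabolicTrajectory.TunedSequenceExists :=
  FixedAspectSplit.tunedSequenceExists_of_slack_mirror_subs hU hV hIn hOut

/-- Wiring check: the registered stubs feed `TunedSequenceExists_of` as stated. -/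
example : Summit.QuantumFields.YangMills.Theses.ParabolicTrajectory.TunedSequenceExists :=
  TunedSequenceExists_of stub_femtoLowerBound stub_volumeSlack stub_mirrorBoundIn stub_mirrorBoundOut

/-! ## Second composition (lead c12): the SAME four stubs imply the REPAIRED conjunct (S_PVG) of the
unified rev-8 banner, BY NAME (kernel-checked; no `sorry` outside the stubs) -/

/-- **`TunedSequenceExistsPVG_of`** — (U_∃h), (V_slack), (A_in), (A_out) imply
`TwoOrbitSynchronisation.TunedSequenceExistsPVG` ((S) with polynomial volume growth in its conclusion):
the landed four-child glue `PVGGlue.tunedSequenceExistsPVG_of_slack_mirror_subs` (all-volume lower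
bound, IVT tuning with prescribed volumes `M^(2 m_k) ≤ L_k`, extraction carrying the clause). -/
theorem TunedSequenceExistsPVG_of (hU : Registered.stub_femtoLowerBound)
    (hV : Registered.stub_volumeSlack) (hIn : Registered.stub_mirrorBoundIn)
    (hOut : Registered.stub_mirrorBoundOut) :
    Summit.QuantumFields.YangMills.Cruxes.ContinuumLimitOnTrajectory.TwoOrbitSynchronisation.TunedSequenceExistsPVG :=
  PVGGlue.tunedSequenceExistsPVG_of_slack_mirror_subs hU hV hIn hOut

/-- Wiring check for the repaired conjunct. -/
example :
    Summit.QuantumFields.YangMills.Cruxes.ContinuumLimitOnTrajectory.TwoOrbitSynchronisation.TunedSequenceExistsPVG :=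
  TunedSequenceExistsPVG_of stub_femtoLowerBound stub_volumeSlack stub_mirrorBoundIn stub_mirrorBoundOut

/-- The repaired conjunct gives back the crux as typed (consistency of the two compositions;
`TwoOrbitSynchronisation.tunedSequenceExists_of_PVG`). -/
example (hU : Registered.stub_femtoLowerBound) (hV : Registered.stub_volumeSlack)
    (hIn : Registered.stub_mirrorBoundIn) (hOut : Registered.stub_mirrorBoundOut) :
    Summit.QuantumFields.YangMills.Theses.ParabolicTrajectory.TunedSequenceExists :=
  Summit.QuantumFields.YangMills.Cruxes.ContinuumLimitOnTrajectory.TwoOrbitSynchronisation.tunedSequenceExists_of_PVG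
    (TunedSequenceExistsPVG_of hU hV hIn hOut)

/-! ## Size certificates (kernel-checked, landed): no stub is the crux core

* (V_slack) and (A_in)/(A_out) are inhabited by the ZERO correlator table
  (`FixedAspectSplit.volumeMonotoneSlackShape_zero`, `FixedAspectSplit.canonicalUpperBoundShape_zero`),
  whereas the core's shape fails for it (`FixedAspectSplit.not_lowerBoundShape_zero`);
* (U_∃h) is inhabited by the aspect-decaying table `M^m/(L+1)` (`femtoLowerBoundShape_aspectDecay`)
  for which the core's shape fails (`not_lowerBoundShape_aspectDecay`): a height that may decay with the
  aspect gives no `θ₀` uniform in the volume floor. -/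

example : FixedAspectSplit.VolumeMonotoneSlackShape (fun _ _ _ => 0) 2 :=
  FixedAspectSplit.volumeMonotoneSlackShape_zero 2

example : FixedAspectSplit.FemtoLowerBoundShape (fun _ m L => (2 : ℝ) ^ m / ((L : ℝ) + 1)) 2 ∧
    ¬ FixedAspectSplit.LowerBoundShape (fun _ m L => (2 : ℝ) ^ m / ((L : ℝ) + 1)) 2 := by
  refine ⟨?_, ?_⟩
  · simpa using FixedAspectSplit.femtoLowerBoundShape_aspectDecay (M := 2) (by norm_num)
  · simpa using FixedAspectSplit.not_lowerBoundShape_aspectDecay (M := 2) (by norm_num)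

/-! ## Certificates against the sibling tier-deciding crux `LangevinControlUV.FemtoCurvatureTwoPointC`
(stmt-QuantumFields-16204) — every piece LANDED `--supports` (leads c5, c6)

* **(V) is NECESSARY modulo the sibling**: every tuned witness of THIS crux lives on NON-femto tori
  (`QFemto.tunedSequenceExists_witnesses_not_femto`, p150401).
* **The `Q`-restated crux costs ONE new child, now in SLACK form**:
  `QFemto.tunedSequenceExistsQ_of_femtoC_of_volumeSlack : FemtoCurvatureTwoPointC →
  QFemto.VolumeMonotoneQSlackAll → RPDiagonalVariant.TunedSequenceExistsQ` (file `…QSlack.lean`), with the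
  femto corners of the child free (`QFemto.volumeSlackQ_femto_pair`, `QFemto.volumeSlackQ_femto_small`). -/

/-- Reference check: the necessity certificate, by name. -/
example := @QFemto.tunedSequenceExists_witnesses_not_femto

end Summit.QuantumFields.YangMills.Cruxes.TunedSequenceExists.FixedAspectWindow

end
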